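import Literature.Computability.FineGrained.NegativeTriangleToMinPlusProductProgram
import HarnessLib

/-!
# Negative Triangle `≤₃` distance product (VW–W 2018, Thm. 4.1): the verified reduction

This file discharges the named fact `negativeTriangle_fgReducible_minPlusProduct` of
`Literature.Computability.FineGrained.SubcubicEquivalencesAPSP` — Vassilevska Williams–Williams,
J. ACM 65 (2018), Thm. 4.1 (p. 27:14, Negative Triangle `≤₃` matrix product (verification)),
rendered against the distance product itself: one `(min,+)`-product `W' ⋆ W'` of the weight matrix
with `⊤` diagonal (`topDiag W`), then the `n²` tests `(W' ⋆ W') i j + W j i < 0`, `i ≠ j`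
(`hasNegativeTriangle_iff_minPlus_holds`, the printed argument "there must exist a `k ∈ [n]` so
that `A[i,k] ⊙ B[k,j] < C[i,j]`. In other words, `i, k, j` is a negative triangle", p. 27:14; for
`⊙ = +` "the tripartiteness requirement is unnecessary", §2 p. 27:7) — by assembling

* the structured word-RAM oracle program `NegTriToMinPlus.prog` and its phase-by-phase symbolic
  execution (`Literature.Computability.FineGrained.NegativeTriangleToMinPlusProductProgram`),
* the decoding of its test words: for codes of `a, b ∈ ℤ ∪ {∞}`, "both codes nonzero and the larger
  one even" says exactly `a + b < 0` (`encode_neg_iff`),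
* the encoding and weight estimates of `SubcubicEquivalencesAPSP` / `GraphPathProblemsBounds`,

into `prog_spec` (on the encoding of `W` the program outputs `[1]`/`[0]` according to
`HasNegativeTriangle W`, after the single query `⌜W'⌝ ++ ⌜W'⌝`, within `48 n² + 35` steps),
`negativeTriangle_fgReducible_minPlusProduct_same c : FGReducible (NegativeTriangle c) (n ↦ n³)
(MinPlusProduct c) (n ↦ n³)` (same weight exponent: the queried matrices have the weights of `W`
and `⊤`), and **`negativeTriangle_fgReducible_minPlusProduct_holds`**.

Budgets (`negativeTriangle_fgReducible_minPlusProduct_same`): word size `w = (c + 7) · inputWidth`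
(all addresses `< 6 n² + 109` and all answer words `≤ max n (4 nᶜ + 1)` are `< (n² + 2)^{c+7} ≤ 2^w`,
`free_lt_capacity`, `answer_lt_capacity`); given `ε > 0` take `δ = min ε (1/3)` and `C = 100`:
time `48 n² + 36 ≤ 100 (n³)^{1-δ} + 100` (`NegTriToAPSP.sq_le_budget`), the ledger of the single
query of size `n` is `(n³)^{1-ε} ≤ (n³)^{1-δ} + 1` (`ledger_le_one`), its length `2 n² + 2`.

## References

* V. Vassilevska Williams, R. R. Williams, *Subcubic equivalences between path, matrix, and triangle
  problems*, J. ACM 65 (2018), Art. 27: Thm. 1.1 (p. 27:3), Def. 3.1 (p. 27:10), §4.1 Thm. 4.1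
  (p. 27:14), §2 p. 27:7. doi:10.1145/3186893
* V. Vassilevska Williams, *On some fine-grained questions in algorithms and complexity*, Proc. ICM
  2018, §2, Def. 2.1 (fine-grained reductions on the word RAM).
-/

namespace Literature.Computability.FineGrained

namespace NegTriToMinPlus

open Cryptography Cryptography.WordRAM Cryptography.WordRAM.SProg Matrix APSPPower

/-! ### Codes detect the sign of a sum -/

/-- **Decoding the test of loop C.** For `a, b ∈ ℤ ∪ {∞}` with codes `⌜·⌝ = encodeWithTopInt`
(`⌜⊤⌝ = 0`, `⌜z⌝ = 2z + 1` for `z ≥ 0`, `⌜-(m+1)⌝ = 2m + 2`): both codes are nonzero and the larger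
one is even iff `a + b < 0` (two negative integers have even codes; two nonnegative ones odd codes;
for `z ≥ 0 > -(m+1)` the sum is negative iff `z ≤ m` iff `2z + 1 < 2m + 2`). [folklore] -/
theorem encode_neg_iff (a b : WithTop ℤ) :
    (encodeWithTopInt a ≠ 0 ∧ encodeWithTopInt b ≠ 0 ∧
        max (encodeWithTopInt a) (encodeWithTopInt b) % 2 = 0) ↔ a + b < 0 := by
  cases a with
  | top => simp [encodeWithTopInt]
  | coe x =>
    cases b with
    | top => simp [encodeWithTopInt]
    | coe y =>
      rw [← WithTop.coe_add, WithTop.coe_lt_zero]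
      simp only [encodeWithTopInt, ne_eq, Nat.add_eq_zero_iff, one_ne_zero, and_false,
        not_false_eq_true, true_and]
      rw [Nat.max_def]
      cases x with
      | ofNat p =>
        cases y with
        | ofNat q =>
          simp only [Int.ofNat_eq_natCast, encodeInt_natCast]
          split_ifs <;> omega
        | negSucc q =>
          simp only [Int.ofNat_eq_natCast, encodeInt_natCast, encodeInt_negSucc]
          simp only [Int.negSucc_eq]
          split_ifs <;> omega
      | negSucc p =>
        cases y with
        | ofNat q =>
          simp only [Int.ofNat_eq_natCast, encodeInt_natCast, encodeInt_negSucc]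
          simp only [Int.negSucc_eq]
          split_ifs <;> omega
        | negSucc q =>
          simp only [encodeInt_negSucc]
          simp only [Int.negSucc_eq]
          split_ifs <;> omega

/-! ### The queried instance: the weight matrix with `⊤` diagonal -/

section instance_

variable {n : ℕ} (W : Matrix (Fin n) (Fin n) ℤ)

/-- `W' = topDiag W`: the weight matrix over `ℤ ∪ {∞}` with `⊤` (no arc) on the diagonal — the two
operands `A = B` of the product instance of VW–W Thm. 4.1 in the non-tripartite `(min,+)` setting
(§2 p. 27:7), literally the matrix of `hasNegativeTriangle_iff_minPlus`. [folklore] -/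
def topDiag : Matrix (Fin n) (Fin n) (WithTop ℤ) :=
  Matrix.of fun a b => if a = b then ⊤ else (W a b : WithTop ℤ)

/-- Entries of `topDiag W`. [folklore] -/
theorem topDiag_apply (a b : Fin n) : topDiag W a b = if a = b then ⊤ else (W a b : WithTop ℤ) :=
  rfl

/-- `topDiag W` has the weight bound of `W`. [folklore] -/
theorem hasBoundedWeights_topDiag {M : ℕ} (hW : HasBoundedWeights (W.map ((↑) : ℤ → WithTop ℤ)) M) :
    HasBoundedWeights (topDiag W) M := by
  intro i j
  rw [topDiag_apply]
  split_ifs with h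
  · exact Or.inl rfl
  · have := hW i j
    rwa [Matrix.map_apply] at this

/-- The instance of the distance product queried by the reduction: `(W', W')`, of size `n`, in
`MinPlusProduct c` whenever `W` is a `NegativeTriangle c` instance. [folklore] -/
def inst (c : ℕ) (hW : HasBoundedWeights (W.map ((↑) : ℤ → WithTop ℤ)) (n ^ c)) :
    (MinPlusProduct c).Inst :=
  ⟨⟨n, (topDiag W, topDiag W)⟩, ⟨hasBoundedWeights_topDiag W hW, hasBoundedWeights_topDiag W hW⟩⟩

/-- The encoding of the queried instance is `⌜W'⌝ ++ ⌜W'⌝`. [folklore] -/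
theorem encode_inst (c : ℕ) (hW : HasBoundedWeights (W.map ((↑) : ℤ → WithTop ℤ)) (n ^ c)) :
    (MinPlusProduct c).encode (inst W c hW) =
      encodeMatrixWithTop (topDiag W) ++ encodeMatrixWithTop (topDiag W) := rfl

/-- The queried instance has size `n`. [folklore] -/
theorem size_inst (c : ℕ) (hW : HasBoundedWeights (W.map ((↑) : ℤ → WithTop ℤ)) (n ^ c)) :
    (MinPlusProduct c).size (inst W c hW) = n := rfl

/-- An oracle answering `MinPlusProduct c` returns `⌜W' ⋆ W'⌝` on the query. [folklore] -/
theorem oracle_answer {c : ℕ} {O : List ℕ → List ℕ} (hO : (MinPlusProduct c).OracleAnswers O)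
    (hW : HasBoundedWeights (W.map ((↑) : ℤ → WithTop ℤ)) (n ^ c)) :
    O (encodeMatrixWithTop (topDiag W) ++ encodeMatrixWithTop (topDiag W)) =
      encodeMatrixWithTop (minPlusProduct (topDiag W) (topDiag W)) := by
  have := hO (inst W c hW)
  rw [encode_inst] at this
  simpa [MinPlusProduct, FGProblem.restrict, FGProblem.ofFun, inst] using this

/-- The words of the answer `⌜W' ⋆ W'⌝` are at most `max n (4 nᶜ + 1)` (the product has weights in
`[-2nᶜ, 2nᶜ]`, `hasBoundedWeights_minPlusProduct`). [folklore] -/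
theorem answer_entries_le {c : ℕ} (hW : HasBoundedWeights (W.map ((↑) : ℤ → WithTop ℤ)) (n ^ c)) :
    ∀ v ∈ encodeMatrixWithTop (minPlusProduct (topDiag W) (topDiag W)),
      v ≤ max n (2 * (n ^ c + n ^ c) + 1) :=
  forall_mem_encodeMatrixWithTop_le
    (hasBoundedWeights_minPlusProduct (hasBoundedWeights_topDiag W hW) (hasBoundedWeights_topDiag W hW))

/-- **The codes of `W'` written by loop A**: entry `t = i n + j` of the query blocks is
`⌜topDiag W i j⌝`. [folklore] -/
theorem codeZ_code_eq (i j : Fin n) :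
    codeZ n (code (W.map ((↑) : ℤ → WithTop ℤ)) (i * n + j)) (i * n + j) =
      encodeWithTopInt (topDiag W i j) := by
  rw [codeZ, code_eq, NegTriToAPSP.div_of_mul_add j.isLt, mul_add_mod_eq j.isLt, topDiag_apply,
    Matrix.map_apply]
  by_cases h : i = j
  · subst h; simp [encodeWithTopInt]
  · rw [if_neg (fun h' => h (Fin.ext h')), if_neg h]

end instance_

/-! ### The flag of loop C decides `HasNegativeTriangle` -/

section flag

variable {n : ℕ} (W : Matrix (Fin n) (Fin n) ℤ)

/-- **Correctness of loop C.** If the answer codes read are those of a matrix `P` and the query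
codes read are those of the transposed entries of `W'`, the final flag is `1` iff some off-diagonal
pair has `P i j + W j i < 0`. [folklore] -/
theorem flagW_eq_one_iff_exists {pv qv : ℕ → ℕ} (P : Matrix (Fin n) (Fin n) (WithTop ℤ))
    (hpv : ∀ i j : Fin n, pv (i * n + j) = encodeWithTopInt (P i j))
    (hqv : ∀ i j : Fin n, qv (i * n + j) = encodeWithTopInt (topDiag W j i)) :
    flagW pv qv (n * n) = 1 ↔ ∃ i j : Fin n, i ≠ j ∧ P i j + (W j i : WithTop ℤ) < 0 := by
  rw [flagW_eq_one_iff]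
  constructor
  · rintro ⟨s, hs, h⟩
    have hn : 0 < n := Nat.pos_of_ne_zero fun h0 => by subst h0; simp at hs
    set i : Fin n := ⟨s / n, Nat.div_lt_of_lt_mul (by rwa [Nat.mul_comm] at hs)⟩ with hi
    set j : Fin n := ⟨s % n, Nat.mod_lt _ hn⟩ with hj
    have hsij : s = i * n + j := by simp only [hi, hj]; exact (Nat.div_add_mod' s n).symm
    rw [hsij, hpv, hqv, negTest_eq_one_iff, encode_neg_iff, topDiag_apply] at h
    by_cases hji : j = i
    · rw [if_pos hji, WithTop.add_top] at h
      exact absurd h (not_lt_of_ge le_top)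
    · rw [if_neg hji] at h
      exact ⟨i, j, Ne.symm hji, h⟩
  · rintro ⟨i, j, hij, h⟩
    refine ⟨i * n + j, NegTriToAPSP.mul_add_lt_mul i.isLt j.isLt, ?_⟩
    rw [hpv, hqv, negTest_eq_one_iff, encode_neg_iff, topDiag_apply, if_neg (Ne.symm hij)]
    exact h

/-- The final flag is the indicator of `HasNegativeTriangle W`
(`hasNegativeTriangle_iff_minPlus_holds`). [folklore] -/
theorem flagW_eq_ite {pv qv : ℕ → ℕ} [Decidable (HasNegativeTriangle W)]
    (hpv : ∀ i j : Fin n, pv (i * n + j) =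
      encodeWithTopInt (minPlusProduct (topDiag W) (topDiag W) i j))
    (hqv : ∀ i j : Fin n, qv (i * n + j) = encodeWithTopInt (topDiag W j i)) :
    flagW pv qv (n * n) = if HasNegativeTriangle W then 1 else 0 := by
  have h1 := flagW_le_one pv qv (n * n)
  have h2 : flagW pv qv (n * n) = 1 ↔ HasNegativeTriangle W := by
    rw [flagW_eq_one_iff_exists W _ hpv hqv, hasNegativeTriangle_iff_minPlus_holds W]
    rfl
  split_ifs with h
  · exact h2.2 h
  · rcases Nat.le_one_iff_eq_zero_or_eq_one.1 h1 with h0 | h0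
    · exact h0
    · exact absurd (h2.1 h0) h

end flag

/-! ### The whole program -/

section Run

variable {n w c : ℕ} {O : List ℕ → List ℕ} (W : Matrix (Fin n) (Fin n) ℤ)

/-- The running time of the reduction on an `n`-vertex instance: `48 n² + 35` steps (`7 (n² + 1)` for
the relocation, `19` setup, `15 n² + 1` loop A, `1` query, `4`, `26 n² + 1` loop C, `2` output).
[folklore] -/
def T (n : ℕ) : ℕ := 48 * (n * n) + 35

open Classical in
/-- **Semantics of the reduction program.** On the encoding of a `NegativeTriangle c` instance `W`,
at a word size holding the input, the addresses (`dFREE n < 2 ^ w`) and the answer words, and with an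
oracle answering `MinPlusProduct c`, `prog` ends within `T n` steps with output
`[1]`/`[0]` according to `HasNegativeTriangle W`, having made the single query `⌜W'⌝ ++ ⌜W'⌝`.
[folklore] -/
theorem prog_spec (hO : (MinPlusProduct c).OracleAnswers O)
    (hWb : HasBoundedWeights (W.map ((↑) : ℤ → WithTop ℤ)) (n ^ c))
    (hwid : inputWidth (inp (W.map ((↑) : ℤ → WithTop ℤ))) ≤ w) (hFw : dFREE n < 2 ^ w)
    (hAw : max n (2 * (n ^ c + n ^ c) + 1) < 2 ^ w) :
    ∃ st' : Store, ExecLE w O prog ⟨(init w (inp (W.map ((↑) : ℤ → WithTop ℤ)))).mem, []⟩ st' (T n) ∧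
      readOut st'.mem = [if HasNegativeTriangle W then 1 else 0] ∧
      st'.queries = [encodeMatrixWithTop (topDiag W) ++ encodeMatrixWithTop (topDiag W)] := by
  set X : Matrix (Fin n) (Fin n) (WithTop ℤ) := W.map ((↑) : ℤ → WithTop ℤ) with hX
  have hD := dD_eq n; have hQA := dQA_eq n; have hQP := dQP_eq n; have hQP2 := dQP2_eq n
  have hOUT := dOUT_eq n; have hFR := dFREE_eq n
  have hcw : ∀ t, code X t < 2 ^ w := code_lt X hwid
  -- relocate
  have hx : ∀ v ∈ inp X, v < 2 ^ w := fun v hv =>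
    lt_of_lt_of_le (lt_two_pow_inputWidth_of_mem _ _ hv) (Nat.pow_le_pow_right Nat.two_pos hwid)
  have hrel := relocate_exec (w := w) (O := O) (x := inp X) (by rw [inp_length]; omega) hx
    (by rw [inp_length]; omega) []
  rw [← init_mem_eq_initFun hwid] at hrel
  -- setup
  obtain ⟨S₁, H₁, hex₁, hL₁, h10, h11, h15, h18, h19, hqa, hqb, hH₁⟩ :=
    setup_spec (O := O) X hFw []
  rw [merge_self] at hex₁
  -- loop A
  have hinv₀ : InvA X w [] 0 ⟨merge S₁ H₁, []⟩ := by
    refine ⟨S₁, H₁, rfl, hL₁, h10, by omega, by omega, by omega, by omega, ?_, hqa, hqb,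
      fun t ht => absurd ht (Nat.not_lt_zero t), fun t ht => absurd ht (Nat.not_lt_zero t), hFw, hcw⟩
    intro t ht
    rw [hH₁ _ (by omega) (by omega), relocated_code X ht]
  obtain ⟨st₂, hex₂, S₂, H₂, rfl, hL₂, -, -, -, -, -, -, hqa₂, hqb₂, hA₂, hB₂, -, -⟩ :=
    loopA_spec (O := O) X hinv₀
  obtain ⟨h2, h3, h4, h5, h6, h7, h8, h9⟩ := hL₂
  -- the query segment is the encoding of the instance `(W', W')`
  have hMA : MatAt H₂ (dQA n) (topDiag W) := fun i j => by
    rw [hA₂ _ (NegTriToAPSP.mul_add_lt_mul i.isLt j.isLt), codeZ_code_eq]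
  have hMB : MatAt H₂ (dQA n + n * n + 1) (topDiag W) := fun i j => by
    rw [show dQA n + n * n + 1 = dQP n from rfl, hB₂ _ (NegTriToAPSP.mul_add_lt_mul i.isLt j.isLt),
      codeZ_code_eq]
  have hseg : readSeg H₂ (dQA n) (2 * (n * n) + 2) =
      encodeMatrixWithTop (topDiag W) ++ encodeMatrixWithTop (topDiag W) :=
    readSeg_operands hqa₂ (by rw [show dQA n + n * n + 1 = dQP n from rfl]; exact hqb₂) hMA hMB
  -- the oracle's answer
  set eP := encodeMatrixWithTop (minPlusProduct (topDiag W) (topDiag W)) with heP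
  have hePlen : eP.length = n * n + 1 := by rw [heP, encodeMatrixWithTop_length, sq]
  have hePw : ∀ v ∈ eP, v < 2 ^ w := fun v hv =>
    lt_of_le_of_lt (answer_entries_le W hWb v hv) hAw
  have hmapP : eP.map (· % 2 ^ w) = eP := by
    rw [List.map_congr_left (fun v hv => Nat.mod_eq_of_lt (hePw v hv)), List.map_id']
  have hexQ := Exec.query_dir (w := w) (O := O) (qa := 5) (ql := 8) (aa := 7) (by omega) (by omega)
    (by omega) (S := S₂) (by rw [h5]; omega) (by rw [h7]; omega) H₂ []
  rw [h5, h8, h7, hseg, oracle_answer W hO hWb, ← heP, hmapP, List.nil_append] at hexQ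
  set H₃ := segWrite H₂ (dQP2 n) eP with hH₃
  have hH₃lo : ∀ a, a < dQP2 n → H₃ a = H₂ a := fun a ha => by
    rw [hH₃]; unfold segWrite; rw [if_neg (by omega), if_neg (by omega)]
  have hH₃ans : ∀ t (ht : t < n * n), H₃ (dQP2 n + 2 + t) = eP[t + 1]'(by rw [hePlen]; omega) := by
    intro t ht
    rw [hH₃]; unfold segWrite
    rw [if_neg (by omega), if_pos ⟨by omega, by rw [hePlen]; omega⟩,
      List.getD_eq_getElem _ _ (by rw [hePlen]; omega)]
    congr 1; omega
  -- loop C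
  set pv : ℕ → ℕ := fun t => H₃ (dQP2 n + 2 + t) with hpv_def
  set qv : ℕ → ℕ := fun t => H₃ (dQA n + 1 + (t % n * n + t / n)) with hqv_def
  have hpw : ∀ t, t < n * n → pv t < 2 ^ w := fun t ht => by
    simp only [hpv_def]
    rw [hH₃ans t ht]
    exact hePw _ (List.getElem_mem _)
  have hqw : ∀ t, t < n * n → qv t < 2 ^ w := fun t ht => by
    have hn : 0 < n := Nat.pos_of_ne_zero fun h0 => by subst h0; simp at ht
    have hs : t % n * n + t / n < n * n :=
      NegTriToAPSP.mul_add_lt_mul (Nat.mod_lt _ hn) (Nat.div_lt_of_lt_mul (by rwa [Nat.mul_comm] at ht))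
    simp only [hqv_def]
    rw [hH₃lo _ (by omega), hA₂ _ hs]
    exact lt_of_le_of_lt (codeZ_le _ _ _) (hcw _)
  obtain ⟨st₄, hex₄, hinv₄⟩ := postOps_spec (O := O) H₃
    [encodeMatrixWithTop (topDiag W) ++ encodeMatrixWithTop (topDiag W)] pv qv
    ⟨h2, h3, h4, h5, h6, h7, h8, h9⟩ hFw
  obtain ⟨st₅, hex₅, hinv₅⟩ := loopC_spec (O := O) H₃ _ pv qv (fun t _ => rfl) (fun t _ => rfl)
    hpw hqw hFw hinv₄
  obtain ⟨S₆, hex₆, h0₆, h1₆⟩ := finOps_spec (O := O) H₃ _ pv qv hFw hinv₅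
  -- assemble the execution
  have hexAll := hrel.execLE.seqs_cons (hex₁.execLE.seqs_cons (hex₂.seqs_cons
    (hexQ.execLE.seqs_cons (hex₄.execLE.seqs_cons (hex₅.seqs_cons (ExecLE.seqs_one hex₆.execLE))))))
  refine ⟨_, hexAll.mono ?_, ?_, rfl⟩
  · unfold T; rw [inp_length]; ring_nf; omega
  · -- the output
    rw [readOut_final H₃ pv qv h0₆ h1₆, flagW_eq_ite W]
    · intro i j
      have ht : (i : ℕ) * n + j < n * n := NegTriToAPSP.mul_add_lt_mul i.isLt j.isLt
      simp only [hpv_def]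
      rw [hH₃ans _ ht]
      exact NegTriToAPSP.getElem_encodeMatrixWithTop_pair (minPlusProduct (topDiag W) (topDiag W)) i j
        (by rw [encodeMatrixWithTop_length, sq]; omega)
    · intro i j
      have ht : (j : ℕ) * n + i < n * n := NegTriToAPSP.mul_add_lt_mul j.isLt i.isLt
      simp only [hqv_def]
      rw [mul_add_mod_eq j.isLt, NegTriToAPSP.div_of_mul_add j.isLt, hH₃lo _ (by omega), hA₂ _ ht,
        codeZ_code_eq]

end Run

/-! ### Word-size arithmetic -/

/-- All addresses fit: `6 n² + 108 < (n² + 2)^{c+7}`. [folklore] -/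
theorem free_lt_capacity (n c : ℕ) : 6 * (n * n) + 108 < (n * n + 1 + 1) ^ (c + 7) := by
  have h1 : (n * n + 1 + 1) ^ 7 ≤ (n * n + 1 + 1) ^ (c + 7) :=
    Nat.pow_le_pow_right (by omega) (by omega)
  have h2 : (n * n + 1 + 1) * 64 ≤ (n * n + 1 + 1) ^ 7 :=
    calc (n * n + 1 + 1) * 64 = (n * n + 1 + 1) * 2 ^ 6 := by norm_num
      _ ≤ (n * n + 1 + 1) * (n * n + 1 + 1) ^ 6 :=
          Nat.mul_le_mul_left _ (Nat.pow_le_pow_left (by omega) 6)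
      _ = (n * n + 1 + 1) ^ 7 := by ring
  omega

/-- The answer words fit: `max n (4 nᶜ + 1) < (n² + 2)^{c+7}`. [folklore] -/
theorem answer_lt_capacity (n c : ℕ) :
    max n (2 * (n ^ c + n ^ c) + 1) < (n * n + 1 + 1) ^ (c + 7) := by
  have hn2 : n < n * n + 1 + 1 := by nlinarith [Nat.zero_le n]
  have hc : n ^ c ≤ (n * n + 1 + 1) ^ c := Nat.pow_le_pow_left hn2.le c
  have h7 : 64 ≤ (n * n + 1 + 1) ^ 7 :=
    le_trans (by norm_num : 64 ≤ 2 ^ 7) (Nat.pow_le_pow_left (by omega) 7)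
  have h1 : 1 ≤ (n * n + 1 + 1) ^ c := Nat.one_le_pow _ _ (by omega)
  have hAB : (n * n + 1 + 1) ^ c * 64 ≤ (n * n + 1 + 1) ^ c * (n * n + 1 + 1) ^ 7 :=
    Nat.mul_le_mul_left _ h7
  have hB : n * n + 1 + 1 ≤ (n * n + 1 + 1) ^ 7 := Nat.le_self_pow (by norm_num) _
  have hfg : (n * n + 1 + 1) ^ 7 ≤ (n * n + 1 + 1) ^ c * (n * n + 1 + 1) ^ 7 :=
    Nat.le_mul_of_pos_left _ h1
  rw [pow_add]
  refine max_lt ?_ ?_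
  · omega
  · omega

/-! ### The reduction -/

/-- The ledger estimate for the single query of size `n`: `(n³)^{1-ε} ≤ (n³)^{1-δ} + 1` whenever
`δ ≤ ε`. [folklore] -/
theorem ledger_le_one {ε δ : ℝ} (hδε : δ ≤ ε) (n : ℕ) :
    ((n : ℝ) ^ (3 : ℝ)) ^ (1 - ε) ≤ ((n : ℝ) ^ (3 : ℝ)) ^ (1 - δ) + 1 := by
  have h0 : (0 : ℝ) ≤ ((n : ℝ) ^ (3 : ℝ)) ^ (1 - δ) :=
    Real.rpow_nonneg (Real.rpow_nonneg (Nat.cast_nonneg _) _) _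
  rcases Nat.eq_zero_or_pos n with rfl | hn
  · have e : ((0 : ℕ) : ℝ) ^ (3 : ℝ) = 0 := by
      rw [Nat.cast_zero, Real.zero_rpow (by norm_num)]
    calc (((0 : ℕ) : ℝ) ^ (3 : ℝ)) ^ (1 - ε) = (0 : ℝ) ^ (1 - ε) := by rw [e]
      _ ≤ 1 := Real.zero_rpow_le_one _
      _ ≤ (((0 : ℕ) : ℝ) ^ (3 : ℝ)) ^ (1 - δ) + 1 := by linarith [h0]
  · have ha : (1 : ℝ) ≤ (n : ℝ) ^ (3 : ℝ) := Real.one_le_rpow (by exact_mod_cast hn) (by norm_num)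
    have := Real.rpow_le_rpow_of_exponent_le ha (show 1 - ε ≤ 1 - δ by linarith)
    linarith

/-- **VW–W 2018, Thm. 4.1, Negative Triangle `≤₃` distance product, proved with the same weight
exponent**: for every `c`, Negative Triangle with weights in `[-nᶜ, nᶜ]` reduces to the
`(min,+)`-product of matrices with entries in `[-nᶜ, nᶜ] ∪ {∞}` by the verified word-RAM program
`prog` — one query `(W', W')` (`W'` = the weight matrix with `⊤` diagonal), then `n²` sign tests of
`(W' ⋆ W') i j + W j i`, `O(n²)` time, word size `(c + 7) · width`; for every `ε > 0` the definition
of `FGReducible` is met with `δ = min ε (1/3)` and `C = 100`. In print (p. 27:14) the target is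
matrix product *verification*, whence the `2n × 2n` paddings `A', B', C` that fold the comparison
with `C` into one verification call; against the product itself (the zoo's `MinPlusProduct`) one
`n × n` product `A ⋆ B` followed by the `n²` comparisons "is there `i, j` with
`minₖ (A[i,k] ⊙ B[k,j]) < C[i,j]`", `C[i,j] = -w(j,i)`, suffices — with `A = B = W'` this is
`hasNegativeTriangle_iff_minPlus`.
[cite: VassilevskaWilliamsWilliams2018, Thm. 4.1 (p. 27:14); §2 p. 27:7] -/
theorem negativeTriangle_fgReducible_minPlusProduct_same (c : ℕ) :
    FGReducible (NegativeTriangle c) (fun n => (n : ℝ) ^ (3 : ℝ)) (MinPlusProduct c)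
      (fun n => (n : ℝ) ^ (3 : ℝ)) := by
  intro ε hε
  refine ⟨min ε (1 / 3), lt_min hε (by norm_num), prog.toProgram, c + 7, 100, prog_isDeterministic, ?_⟩
  intro O hO x
  obtain ⟨⟨n, W⟩, hWb⟩ := x
  change HasBoundedWeights (W.map ((↑) : ℤ → WithTop ℤ)) (n ^ c) at hWb
  have hδ3 : min ε (1 / 3) ≤ 1 / 3 := min_le_right _ _
  have hδε : min ε (1 / 3) ≤ ε := min_le_left _ _
  have hbud0 : (0 : ℝ) ≤ ((n : ℝ) ^ (3 : ℝ)) ^ (1 - min ε (1 / 3)) :=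
    Real.rpow_nonneg (Real.rpow_nonneg (Nat.cast_nonneg _) _) _
  have hsq := NegTriToAPSP.sq_le_budget hδ3 n
  -- the word size
  set w : ℕ := (c + 7) * inputWidth (inp (W.map ((↑) : ℤ → WithTop ℤ))) with hw_def
  have hwid : inputWidth (inp (W.map ((↑) : ℤ → WithTop ℤ))) ≤ w := inputWidth_le_mul (by omega) _
  have hcap : ∀ v, v < (n * n + 1 + 1) ^ (c + 7) → v < 2 ^ w := fun v hv =>
    lt_two_pow_mul_inputWidth (by rw [inp_length]; exact hv)
  have hFw : dFREE n < 2 ^ w := hcap _ (by rw [dFREE_eq]; exact free_lt_capacity n c)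
  have hAw : max n (2 * (n ^ c + n ^ c) + 1) < 2 ^ w := hcap _ (answer_lt_capacity n c)
  obtain ⟨st', ⟨t, ht, hex⟩, hout, hqs⟩ := prog_spec (O := O) W hO hWb hwid hFw hAw
  refine ⟨st'.cfg none 0, [inst W c hWb], ?_, ?_, ?_, ?_, ?_⟩
  · -- the run halts within the budget
    refine haltsWithin_toProgram hex (Nat.le_floor ?_) zeroCoins
    change ((t + 1 : ℕ) : ℝ) ≤ 100 * ((n : ℝ) ^ (3 : ℝ)) ^ (1 - min ε (1 / 3)) + 100
    have hT : ((t + 1 : ℕ) : ℝ) ≤ 48 * ((n : ℝ) * n) + 36 := by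
      have : t + 1 ≤ 48 * (n * n) + 36 := by unfold T at ht; omega
      exact_mod_cast this
    nlinarith
  · -- the output is the accepted one
    change readOut st'.mem ∈ (FGProblem.ofPred
      (fun W : Σ n, Matrix (Fin n) (Fin n) ℤ => encodeMatrixWithTop (W.2.map (↑))) (·.1)
      (fun W : Σ n, Matrix (Fin n) (Fin n) ℤ => HasNegativeTriangle W.2)).Good ⟨n, W⟩
    rw [hout]
    by_cases h : HasNegativeTriangle W
    · rw [if_pos h, FGProblem.ofPred_good_of_pos _ _
        (fun W : Σ n, Matrix (Fin n) (Fin n) ℤ => HasNegativeTriangle W.2) ⟨n, W⟩ h]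
      exact Set.mem_singleton _
    · rw [if_neg h, FGProblem.ofPred_good_of_neg _ _
        (fun W : Σ n, Matrix (Fin n) (Fin n) ℤ => HasNegativeTriangle W.2) ⟨n, W⟩ h]
      exact Set.mem_singleton _
  · -- the query log lists the encoding of the queried instance
    rw [List.map_singleton, encode_inst]
    exact hqs
  · -- the ledger of Def. 2.1
    simp only [List.map_cons, List.map_nil, List.sum_cons, List.sum_nil, add_zero]
    change (((n : ℕ) : ℝ) ^ (3 : ℝ)) ^ (1 - ε) ≤ 100 * ((n : ℝ) ^ (3 : ℝ)) ^ (1 - min ε (1 / 3)) + 100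
    have := ledger_le_one hδε n
    linarith
  · -- the total query length
    simp only [List.map_cons, List.map_nil, List.sum_cons, List.sum_nil, add_zero]
    rw [encode_inst, List.length_append, encodeMatrixWithTop_length]
    change (((n ^ 2 + 1 + (n ^ 2 + 1) : ℕ)) : ℝ) ≤ 100 * ((n : ℝ) ^ (3 : ℝ)) ^ (1 - min ε (1 / 3)) + 100
    push_cast
    nlinarith

end NegTriToMinPlus

/-- **Discharge of `negativeTriangle_fgReducible_minPlusProduct`** (VW–W 2018, Thm. 4.1: Negative
Triangle `≤₃` distance product): take `c' = c`.
[cite: VassilevskaWilliamsWilliams2018, Thm. 4.1 (p. 27:14)] -/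
theorem negativeTriangle_fgReducible_minPlusProduct_holds : negativeTriangle_fgReducible_minPlusProduct :=
  fun c => ⟨c, NegTriToMinPlus.negativeTriangle_fgReducible_minPlusProduct_same c⟩

end Literature.Computability.FineGrained
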